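import Literature.NumberTheory.LFunctions.WeilExplicitDirichletProofs
import Literature.NumberTheory.LFunctions.WeilExplicitArchTermProofs
import HarnessLib

/-!
# The archimedean term with parity `a` in position space (Weil 1952 (10)/(11), Bombieri (2.8) with `a`)

Sibling of `WeilExplicitArchTermProofs.lean` (the case `a = 0`, Bombieri 2000 §2 (2.5)–(2.8)) and of
`WeilExplicitDirichlet.lean` (`weilArchIntegralChar a g = ∫ ĝ(1/2+it) Re ψ(1/4 + a/2 + it/2) dt`, the
kernel of the explicit formula of an `L(s, χ)` with Gamma factor `Γ_ℝ(s + a)`, `a ∈ {0, 1}`).  For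
every test function `g` and `a ∈ {0, 1}`, with `k(x) = g(x) + g(−x)`:

  `(1/2π) weilArchIntegralChar a g = −(log 4 + γ) g(0) − ∫₀^∞ (e^{(1/2−a)x} k(x) − 2 g(0)) dx/(2 sinh x)`

(`weilArchIntegralChar_eq_position`).  The proof is Bombieri's computation (2.5)–(2.8) verbatim with
`w = (s + a)/2` in place of `w = s/2`: the series `ψ(w) + γ = Σₙ (1/(n+1) − 1/(w+n))` integrated term
by term against `k̂(s)` on `Re s = 1/2` (`hasSum_integral_weilMellin_mul_digammaSeries_parity`), the
polar integrals `∫ k̂(s)/(s + 2n + a) dy = 2π ∫₀^∞ k(x) e^{−(2n+a+1/2)x} dx`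
(`integral_weilMellin_mul_digammaSeriesTerm_parity`), the expansion `1/(2 sinh x) = Σₙ e^{−(2n+1)x}`
(`hasSum_integral_bombieriTerms_parity`) and `Σₙ (2/(2n+1) − 1/(n+1)) = log 4`.  It is the
position-space half of Weil's dictionary between the `PF`-form and the digamma form of the
archimedean term of (11) (Weil pp. 258–261, (5), (10)).

## References

* E. Bombieri, *Remarks on Weil's quadratic functional in the theory of prime numbers I*, Rend.
  Mat. Acc. Lincei (9) 11 (2000), 183–233, §2, eq. (2.5)–(2.8). [Bombieri2000Weil]
* A. Weil, *Sur les "formules explicites" de la théorie des nombres premiers*, Comm. Sém. Math.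
  Univ. Lund (1952), 252–265, (5) p. 254, (10) p. 258, pp. 260–261. [Weil1952FormulesExplicites]
-/

noncomputable section

open Complex Filter Set MeasureTheory
open scoped Real Topology ContDiff

namespace Literature.NumberTheory.LFunctions

namespace WeilArchParity

variable {g k : ℝ → ℂ}

/-! ### The digamma series under the integral sign, shifted by the parity -/

/-- `Re((1/2 + iy + a)/2) = 1/4 + a/2`. [folklore] -/
private theorem re_w (a : ℕ) (y : ℝ) : ((((1 / 2 : ℝ) : ℂ) + y * I + a) / 2).re = 1 / 4 + a / 2 := by
  simp; ring

/-- `Im((1/2 + iy + a)/2) = y/2`. [folklore] -/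
private theorem im_w (a : ℕ) (y : ℝ) : ((((1 / 2 : ℝ) : ℂ) + y * I + a) / 2).im = y / 2 := by
  simp

/-- `Re((1/2 + iy + a)/2) > 0`. [folklore] -/
private theorem re_w_pos (a : ℕ) (y : ℝ) : 0 < ((((1 / 2 : ℝ) : ℂ) + y * I + a) / 2).re := by
  rw [re_w]; positivity

/-- `(1/2 + iy + a)/2 + n ≠ 0`. [folklore] -/
private theorem w_add_nat_ne_zero (a : ℕ) (y : ℝ) (n : ℕ) :
    (((1 / 2 : ℝ) : ℂ) + y * I + a) / 2 + n ≠ 0 := by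
  intro h0
  have h1 := congrArg Complex.re h0
  rw [add_re, re_w] at h1
  simp at h1
  have hn : (0 : ℝ) ≤ n := n.cast_nonneg
  have ha : (0 : ℝ) ≤ a := a.cast_nonneg
  linarith

/-- **Term-by-term integration of the shifted digamma series on the critical line** (Bombieri (2.5)
with `w = (s+a)/2`): for a test function `k`, `s = 1/2 + iy`,
`Σₙ ∫ k̂(s)(1/(n+1) − 1/(w+n)) dy = ∫ k̂(s)(ψ(w) + γ) dy`. [cite: Bombieri2000Weil, §2 eq. (2.5)] -/
theorem hasSum_integral_weilMellin_mul_digammaSeries_parity (hk : IsWeilTest k) (a : ℕ) :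
    HasSum (fun n : ℕ ↦ ∫ y : ℝ, weilMellin k (((1 / 2 : ℝ) : ℂ) + y * I) *
        (1 / ((n : ℂ) + 1) - 1 / ((((1 / 2 : ℝ) : ℂ) + y * I + a) / 2 + n)))
      (∫ y : ℝ, weilMellin k (((1 / 2 : ℝ) : ℂ) + y * I) *
        (digamma ((((1 / 2 : ℝ) : ℂ) + y * I + a) / 2) + Real.eulerMascheroniConstant)) := by
  have hw := re_w_pos a
  have hmin : ∀ y : ℝ, 1 / 4 ≤ min ((((1 / 2 : ℝ) : ℂ) + y * I + a) / 2).re 1 := fun y ↦ by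
    rw [re_w]
    refine le_min ?_ (by norm_num)
    have ha : (0 : ℝ) ≤ a := a.cast_nonneg
    linarith
  have hne := w_add_nat_ne_zero a
  have hS : Summable fun n : ℕ ↦ 1 / ((n : ℝ) + 1) ^ 2 := by
    have h := (Real.summable_one_div_nat_pow.2 one_lt_two)
    exact_mod_cast (summable_nat_add_iff 1).2 h
  set A : ℝ := (a : ℝ) / 2 + 1 with hA
  refine hasSum_integral_of_dominated_convergence
    (fun (n : ℕ) (y : ℝ) ↦ 4 * ‖(((1 / 2 : ℝ) : ℂ) + y * I + a) / 2 - 1‖ *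
      ‖weilMellin k (((1 / 2 : ℝ) : ℂ) + y * I)‖ * (1 / ((n : ℝ) + 1) ^ 2))
    (fun n ↦ ?_) (fun n ↦ Eventually.of_forall fun y ↦ ?_) (Eventually.of_forall fun y ↦ ?_) ?_
    (Eventually.of_forall fun y ↦ ?_)
  · -- measurability
    exact ((continuous_weilMellin_vertical hk.1.continuous hk.2 _).mul
      (continuous_const.sub (continuous_const.div (by fun_prop) fun y ↦ hne y n))).aestronglyMeasurable
  · -- the bound
    rw [norm_mul]
    have h := Literature.Analysis.SpecialFunctions.Complex.norm_one_div_sub_one_div_le (hw y) n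
    have hk0 := norm_nonneg (weilMellin k (((1 / 2 : ℝ) : ℂ) + y * I))
    have hn1 : (0 : ℝ) < ((n : ℝ) + 1) ^ 2 := by positivity
    have h' : ‖1 / ((n : ℂ) + 1) - 1 / ((((1 / 2 : ℝ) : ℂ) + y * I + a) / 2 + n)‖ ≤
        ‖(((1 / 2 : ℝ) : ℂ) + y * I + a) / 2 - 1‖ / (1 / 4 * ((n : ℝ) + 1) ^ 2) :=
      h.trans (div_le_div_of_nonneg_left (norm_nonneg _) (by positivity)
        (mul_le_mul_of_nonneg_right (hmin y) hn1.le))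
    calc ‖weilMellin k (((1 / 2 : ℝ) : ℂ) + y * I)‖ *
          ‖1 / ((n : ℂ) + 1) - 1 / ((((1 / 2 : ℝ) : ℂ) + y * I + a) / 2 + n)‖
        ≤ ‖weilMellin k (((1 / 2 : ℝ) : ℂ) + y * I)‖ *
          (‖(((1 / 2 : ℝ) : ℂ) + y * I + a) / 2 - 1‖ / (1 / 4 * ((n : ℝ) + 1) ^ 2)) :=
          mul_le_mul_of_nonneg_left h' hk0
      _ = 4 * ‖(((1 / 2 : ℝ) : ℂ) + y * I + a) / 2 - 1‖ *
          ‖weilMellin k (((1 / 2 : ℝ) : ℂ) + y * I)‖ * (1 / ((n : ℝ) + 1) ^ 2) := by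
          field_simp
  · -- summability of the bound
    exact hS.mul_left _
  · -- integrability of the summed bound
    simp_rw [tsum_mul_left]
    refine Integrable.mul_const ?_ _
    have hF : Continuous fun y : ℝ ↦ (4 : ℂ) * ((((1 / 2 : ℝ) : ℂ) + y * I + a) / 2 - 1) := by fun_prop
    have hI := integrable_mul_weilMellin_vertical_of_norm_le_linear hk (1 / 2) hF (C := 4 * A)
      fun y ↦ ?_
    · refine hI.norm.congr (Eventually.of_forall fun y ↦ ?_)
      simp only [norm_mul]
      norm_num
    · rw [norm_mul]
      have hre : ((((1 / 2 : ℝ) : ℂ) + y * I + a) / 2 - 1).re = a / 2 - 3 / 4 := by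
        rw [sub_re, re_w]; norm_num; ring
      have him : ((((1 / 2 : ℝ) : ℂ) + y * I + a) / 2 - 1).im = y / 2 := by rw [sub_im, im_w]; simp
      have ha : (0 : ℝ) ≤ a := a.cast_nonneg
      have h1 : ‖(((1 / 2 : ℝ) : ℂ) + y * I + a) / 2 - 1‖ ≤ A * (1 + |y|) := by
        refine (Complex.norm_le_abs_re_add_abs_im _).trans ?_
        rw [hre, him]
        have hb : |y / 2| = |y| / 2 := by rw [abs_div, abs_two]
        have hc : |(a : ℝ) / 2 - 3 / 4| ≤ a / 2 + 3 / 4 := (abs_sub _ _).trans (by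
          rw [abs_of_nonneg (by positivity), abs_of_nonneg (by norm_num)])
        rw [hb, hA]
        have := abs_nonneg y
        nlinarith
      have h4 : ‖(4 : ℂ)‖ = 4 := by norm_num
      rw [h4, mul_assoc]
      exact mul_le_mul_of_nonneg_left h1 (by norm_num)
  · -- pointwise: the series of Andrews–Askey–Roy (1.2.13)
    exact (Literature.Analysis.SpecialFunctions.Complex.hasSum_one_div_sub_one_div_digamma
      (hw y)).mul_left _

/-- **The terms are polar integrals** (Bombieri (2.6) with `w = (s+a)/2`): for a test function `k`,
`n ≥ 0`, `s = 1/2 + iy`: `1/(w + n) = 2/(s + 2n + a)` and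
`∫ k̂(s)(1/(n+1) − 1/(w+n)) dy = 2π k(0)/(n+1) − 4π ∫₀^∞ k(x) e^{−(2n+a+1/2)x} dx`.
[cite: Bombieri2000Weil, §2 eq. (2.6)] -/
theorem integral_weilMellin_mul_digammaSeriesTerm_parity (hk : IsWeilTest k) (a n : ℕ) :
    ∫ y : ℝ, weilMellin k (((1 / 2 : ℝ) : ℂ) + y * I) *
        (1 / ((n : ℂ) + 1) - 1 / ((((1 / 2 : ℝ) : ℂ) + y * I + a) / 2 + n)) =
      2 * π * k 0 / ((n : ℂ) + 1) -
        4 * π * ∫ x in Ioi (0 : ℝ), k x * cexp ((-(2 * (n : ℂ) + a) - 1 / 2) * x) := by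
  have h1 : Integrable fun y : ℝ ↦ weilMellin k (((1 / 2 : ℝ) : ℂ) + y * I) :=
    integrable_weilMellin_vertical hk _
  have hn : (0 : ℝ) ≤ n := n.cast_nonneg
  have ha : (0 : ℝ) ≤ a := a.cast_nonneg
  have hre : (-(2 * (n : ℂ) + a)).re < (1 / 2 : ℝ) := by
    simp; linarith
  have h2 := integral_weilMellin_vertical_div_sub hk (c := 1 / 2) (a := -(2 * (n : ℂ) + a)) hre
  have h2i := integrable_weilMellin_vertical_div_sub hk (c := 1 / 2) (a := -(2 * (n : ℂ) + a)) hre.ne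
  have e : ∀ y : ℝ, weilMellin k (((1 / 2 : ℝ) : ℂ) + y * I) *
      (1 / ((n : ℂ) + 1) - 1 / ((((1 / 2 : ℝ) : ℂ) + y * I + a) / 2 + n)) =
      1 / ((n : ℂ) + 1) * weilMellin k (((1 / 2 : ℝ) : ℂ) + y * I) -
        2 * (weilMellin k (((1 / 2 : ℝ) : ℂ) + y * I) /
          (((1 / 2 : ℝ) : ℂ) + y * I - -(2 * (n : ℂ) + a))) := by
    intro y
    have hne := w_add_nat_ne_zero a y n
    have hne' : ((1 / 2 : ℝ) : ℂ) + y * I - -(2 * (n : ℂ) + a) ≠ 0 := by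
      intro h0
      have h1 := congrArg Complex.re h0
      simp at h1
      linarith
    have hn1 : (n : ℂ) + 1 ≠ 0 := by
      have : ((n + 1 : ℕ) : ℂ) ≠ 0 := Nat.cast_ne_zero.2 (Nat.succ_ne_zero n)
      simpa using this
    have key : 1 / ((((1 / 2 : ℝ) : ℂ) + y * I + a) / 2 + n) =
        2 / (((1 / 2 : ℝ) : ℂ) + y * I - -(2 * (n : ℂ) + a)) := by
      rw [div_eq_div_iff hne hne']
      ring
    rw [key]
    ring
  simp_rw [e]
  rw [integral_sub (h1.const_mul _) (h2i.const_mul 2), integral_const_mul, integral_const_mul,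
    integral_weilMellin_vertical hk, h2]
  ring

/-- Integrability of `y ↦ k̂(1/2+iy) ψ((1/2+iy+a)/2)` (`|ψ| ≪ log(2+|y|)` on the line
`Re w = 1/4 + a/2 > 0`). [folklore] -/
private theorem integrable_weilMellin_mul_digamma (hk : IsWeilTest k) (a : ℕ) :
    Integrable fun y : ℝ ↦ weilMellin k (((1 / 2 : ℝ) : ℂ) + y * I) *
      digamma ((((1 / 2 : ℝ) : ℂ) + y * I + a) / 2) := by
  obtain ⟨C, hC⟩ := Literature.Analysis.SpecialFunctions.Complex.exists_norm_digamma_vertical_le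
    (a := 1 / 4 + (a : ℝ) / 2) (by positivity)
  have h := integrable_mul_weilMellin_vertical_of_norm_le_log hk (1 / 2)
    (F := fun y : ℝ ↦ digamma ((((1 / 2 : ℝ) : ℂ) + y * I + a) / 2)) ?_ (C := |C|) fun y ↦ ?_
  · refine h.congr (Eventually.of_forall fun y ↦ ?_)
    simp only
    push_cast
    ring
  · refine Literature.Analysis.SpecialFunctions.Complex.continuousOn_digamma.comp_continuous
      (by fun_prop) fun y ↦ ?_
    simp only [mem_setOf_eq]
    exact re_w_pos a y
  · have hw : (((1 / 2 : ℝ) : ℂ) + y * I + a) / 2 =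
        (((1 / 4 + (a : ℝ) / 2 : ℝ) : ℂ) + ((y / 2 : ℝ) : ℂ) * I) := by
      push_cast; ring
    rw [hw]
    have h1 := hC (y / 2)
    have h2 : Real.log (1 + |y / 2|) ≤ Real.log (1 + |y|) := by
      refine Real.log_le_log (by positivity) ?_
      rw [abs_div, abs_two]; linarith [abs_nonneg y]
    linarith [le_abs_self C]

/-- **The archimedean integral with parity as a series** (Bombieri (2.5)–(2.7) with `w = (s+a)/2`):
for a test function `g` and `a ∈ {0, 1}`,
`Σₙ (4π g(0)/(n+1) − 4π ∫₀^∞ (g(x) + g(−x)) e^{−(2n+a+1/2)x} dx) = 2·weilArchIntegralChar a g + 4πγ g(0)`.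
[cite: Bombieri2000Weil, §2 eq. (2.7)] -/
theorem hasSum_weilArchIntegralChar (hg : IsWeilTest g) {a : ℕ} (ha : a ≤ 1) :
    HasSum (fun n : ℕ ↦ 4 * π * g 0 / ((n : ℂ) + 1) -
        4 * π * ∫ x in Ioi (0 : ℝ), (g x + g (-x)) * cexp ((-(2 * (n : ℂ) + a) - 1 / 2) * x))
      (2 * weilArchIntegralChar a g + 4 * π * Real.eulerMascheroniConstant * g 0) := by
  have hk : IsWeilTest (weilSymm g) := hg.weilSymm
  have ha0 : (0 : ℝ) ≤ (a : ℝ) := a.cast_nonneg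
  have ha1 : (a : ℝ) ≤ 1 := by exact_mod_cast ha
  -- the archimedean integral on the critical line against `k̂`
  have h0 : weilArchIntegralChar a g = ∫ y : ℝ, 1 / 2 * digamma ((((1 / 2 : ℝ) : ℂ) + y * I + a) / 2) *
      weilMellin (weilSymm g) (((1 / 2 : ℝ) : ℂ) + y * I) := by
    have hshift := WeilExplicitDirichletProofs.integral_digammaShift_mul_weilMellin_shift hk ha0 ha1
    simp only [Complex.ofReal_natCast] at hshift
    rw [← WeilExplicitDirichletProofs.integral_digammaShift_mul_weilMellin_weilSymm hg ha, hshift]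
  have hIψ : Integrable fun y : ℝ ↦ weilMellin (weilSymm g) (((1 / 2 : ℝ) : ℂ) + y * I) *
      digamma ((((1 / 2 : ℝ) : ℂ) + y * I + a) / 2) := integrable_weilMellin_mul_digamma hk a
  have hI1 : Integrable fun y : ℝ ↦ weilMellin (weilSymm g) (((1 / 2 : ℝ) : ℂ) + y * I) :=
    integrable_weilMellin_vertical hk _
  have hsplit : (∫ y : ℝ, weilMellin (weilSymm g) (((1 / 2 : ℝ) : ℂ) + y * I) *
      (digamma ((((1 / 2 : ℝ) : ℂ) + y * I + a) / 2) + Real.eulerMascheroniConstant)) =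
      2 * weilArchIntegralChar a g + 4 * π * Real.eulerMascheroniConstant * g 0 := by
    have e : (fun y : ℝ ↦ weilMellin (weilSymm g) (((1 / 2 : ℝ) : ℂ) + y * I) *
        (digamma ((((1 / 2 : ℝ) : ℂ) + y * I + a) / 2) + Real.eulerMascheroniConstant)) =
        fun y : ℝ ↦ weilMellin (weilSymm g) (((1 / 2 : ℝ) : ℂ) + y * I) *
          digamma ((((1 / 2 : ℝ) : ℂ) + y * I + a) / 2) +
          weilMellin (weilSymm g) (((1 / 2 : ℝ) : ℂ) + y * I) * Real.eulerMascheroniConstant := by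
      funext y; ring
    rw [e, integral_add hIψ (hI1.mul_const _), integral_mul_const, integral_weilMellin_vertical hk,
      weilSymm_zero, h0, ← integral_const_mul]
    have e2 : (fun y : ℝ ↦ (2 : ℂ) * (1 / 2 * digamma ((((1 / 2 : ℝ) : ℂ) + y * I + a) / 2) *
        weilMellin (weilSymm g) (((1 / 2 : ℝ) : ℂ) + y * I))) =
        fun y : ℝ ↦ weilMellin (weilSymm g) (((1 / 2 : ℝ) : ℂ) + y * I) *
          digamma ((((1 / 2 : ℝ) : ℂ) + y * I + a) / 2) := by
      funext y; ring
    rw [e2]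
    ring
  have hA := hasSum_integral_weilMellin_mul_digammaSeries_parity hk a
  simp_rw [integral_weilMellin_mul_digammaSeriesTerm_parity hk] at hA
  rw [hsplit, weilSymm_zero] at hA
  convert hA using 1
  funext n
  simp only [weilSymm]
  ring

/-! ### Bombieri's side with parity: `(e^{(1/2−a)x} k(x) − k(0))/(2 sinh x)` -/

/-- The numerator `h_a(x) = e^{(1/2−a)x} k(x) − k(0)` is `O(x)` at `0`: `‖h_a(x)‖ ≤ M x` on `[0, 1]`.
[folklore] -/
private theorem exists_norm_numerator_le_mul (hk : IsWeilTest k) (a : ℕ) :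
    ∃ M : ℝ, 0 ≤ M ∧ ∀ x ∈ Icc (0 : ℝ) 1,
      ‖(Real.exp ((1 / 2 - a) * x) : ℂ) * k x - k 0‖ ≤ M * x := by
  set h : ℝ → ℂ := fun x ↦ (Real.exp ((1 / 2 - a) * x) : ℂ) * k x with hh
  have he : ContDiff ℝ ∞ fun x : ℝ ↦ ((Real.exp ((1 / 2 - a) * x) : ℝ) : ℂ) := by
    have := Complex.ofRealCLM.contDiff.comp
      ((Real.contDiff_exp (n := ∞)).comp ((contDiff_const (c := (1 / 2 - (a : ℝ)))).mul contDiff_id))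
    simpa [Function.comp_def] using this
  have hd : ContDiff ℝ ∞ h := he.mul hk.1
  have hcont : Continuous (deriv h) := hd.continuous_deriv (by simp)
  obtain ⟨M, hM⟩ := (isCompact_Icc (a := (0 : ℝ)) (b := 1)).exists_bound_of_continuousOn
    hcont.continuousOn
  have hM0 : 0 ≤ M := (norm_nonneg _).trans (hM 0 (left_mem_Icc.2 zero_le_one))
  refine ⟨M, hM0, fun x hx ↦ ?_⟩
  have hdiff : ∀ y ∈ Icc (0 : ℝ) 1, DifferentiableAt ℝ h y := fun y _ ↦
    (hd.differentiable (by simp)) y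
  have hmv := (convex_Icc (0 : ℝ) 1).norm_image_sub_le_of_norm_deriv_le hdiff
    (fun y hy ↦ hM y hy) (left_mem_Icc.2 zero_le_one) hx
  have h0 : h 0 = k 0 := by simp [hh]
  rw [h0, sub_zero, Real.norm_eq_abs, abs_of_nonneg hx.1] at hmv
  simpa [hh] using hmv

/-- **Bombieri's integrand with parity is absolutely integrable**:
`‖e^{(1/2−a)x}k(x) − k(0)‖/(2 sinh x)` is integrable on `(0, ∞)` (bounded near `0`, `O(e^{−x/2})` at
infinity since `a ≥ 0`). [folklore] -/
private theorem integrableOn_majorant (hk : IsWeilTest k) (a : ℕ) :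
    IntegrableOn (fun x : ℝ ↦ ‖(Real.exp ((1 / 2 - a) * x) : ℂ) * k x - k 0‖ / (2 * Real.sinh x))
      (Ioi 0) := by
  obtain ⟨M, hM0, hM⟩ := exists_norm_numerator_le_mul hk a
  obtain ⟨K, hK⟩ := hk.1.continuous.bounded_above_of_compact_support hk.2
  have hkc : Continuous k := hk.1.continuous
  have hK0 : 0 ≤ K := (norm_nonneg _).trans (hK 0)
  have ha : (0 : ℝ) ≤ a := a.cast_nonneg
  set C : ℝ := M / 2 * Real.exp (1 / 2) + 4 * K with hC
  have hC0 : 0 ≤ C := by positivity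
  refine Integrable.mono' ((exp_neg_integrableOn_Ioi 0 (by norm_num : (0 : ℝ) < 1 / 2)).const_mul C)
    ?_ ?_
  · refine (Measurable.div ?_ ?_).aestronglyMeasurable
    · exact (by fun_prop : Continuous fun x : ℝ ↦
        ‖(Real.exp ((1 / 2 - a) * x) : ℂ) * k x - k 0‖).measurable
    · exact (by fun_prop : Continuous fun x : ℝ ↦ 2 * Real.sinh x).measurable
  · refine (ae_restrict_iff' measurableSet_Ioi).2 (Eventually.of_forall fun x (hx : 0 < x) ↦ ?_)
    have hsinh : 0 < Real.sinh x := Real.sinh_pos_iff.2 hx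
    have h2s : 0 < 2 * Real.sinh x := by positivity
    rw [Real.norm_eq_abs, abs_of_nonneg (div_nonneg (norm_nonneg _) h2s.le), div_le_iff₀ h2s]
    rcases le_or_gt x 1 with hx1 | hx1
    · have e1 : 1 ≤ Real.exp (1 / 2) * Real.exp (-(1 / 2) * x) := by
        rw [← Real.exp_add]; exact Real.one_le_exp (by linarith)
      have e2 : x ≤ Real.sinh x := Real.self_le_sinh_iff.2 hx.le
      calc ‖(Real.exp ((1 / 2 - a) * x) : ℂ) * k x - k 0‖ ≤ M * x := hM x ⟨hx.le, hx1⟩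
        _ ≤ M * Real.sinh x := by gcongr
        _ ≤ M * Real.sinh x * (Real.exp (1 / 2) * Real.exp (-(1 / 2) * x)) :=
            le_mul_of_one_le_right (by positivity) e1
        _ = M / 2 * Real.exp (1 / 2) * Real.exp (-(1 / 2) * x) * (2 * Real.sinh x) := by ring
        _ ≤ C * Real.exp (-(1 / 2) * x) * (2 * Real.sinh x) := by
            gcongr
            rw [hC]
            linarith [mul_nonneg (by norm_num : (0 : ℝ) ≤ 4) hK0]
    · have hE1 : Real.exp ((1 / 2 - a) * x) ≤ Real.exp (x / 2) :=
        Real.exp_le_exp.2 (by nlinarith)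
      have hprod : Real.exp (-(1 / 2) * x) * Real.exp x = Real.exp (x / 2) := by
        rw [← Real.exp_add]; ring_nf
      have hex2 : (2 : ℝ) ≤ Real.exp x := by linarith [Real.add_one_le_exp x]
      have h2s' : Real.exp x / 2 ≤ 2 * Real.sinh x := by
        rw [Real.sinh_eq]
        have : Real.exp (-x) ≤ 1 := Real.exp_le_one_iff.2 (by linarith)
        linarith
      have hE2 : 1 ≤ Real.exp (x / 2) := Real.one_le_exp (by positivity)
      have hh : ‖(Real.exp ((1 / 2 - a) * x) : ℂ) * k x - k 0‖ ≤ Real.exp (x / 2) * K + K := by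
        refine (norm_sub_le _ _).trans (add_le_add ?_ (hK 0))
        rw [norm_mul, Complex.norm_real, Real.norm_of_nonneg (Real.exp_pos _).le]
        exact mul_le_mul hE1 (hK x) (norm_nonneg _) (Real.exp_pos _).le
      calc ‖(Real.exp ((1 / 2 - a) * x) : ℂ) * k x - k 0‖ ≤ Real.exp (x / 2) * K + K := hh
        _ ≤ 2 * K * Real.exp (x / 2) := by nlinarith
        _ ≤ C / 2 * Real.exp (x / 2) := by
            gcongr
            rw [hC]
            nlinarith [Real.exp_pos (1 / 2)]
        _ = C * Real.exp (-(1 / 2) * x) * (Real.exp x / 2) := by rw [mul_assoc, ← hprod]; ring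
        _ ≤ C * Real.exp (-(1 / 2) * x) * (2 * Real.sinh x) := by gcongr

/-- **Expansion of Bombieri's integral with parity** (Bombieri (2.7)–(2.8) with `a`): for a test
function `k`,
`Σₙ ∫₀^∞ (k(x) e^{−(2n+a+1/2)x} − k(0) e^{−(2n+1)x}) dx = ∫₀^∞ (e^{(1/2−a)x} k(x) − k(0)) dx/(2 sinh x)`
(`1/(2 sinh x) = Σₙ e^{−(2n+1)x}`, dominated convergence). [cite: Bombieri2000Weil, §2 eq. (2.8)] -/
theorem hasSum_integral_bombieriTerms_parity (hk : IsWeilTest k) (a : ℕ) :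
    HasSum (fun n : ℕ ↦ ∫ x in Ioi (0 : ℝ),
        (k x * cexp ((-(2 * (n : ℂ) + a) - 1 / 2) * x) - k 0 * cexp (-(2 * (n : ℂ) + 1) * x)))
      (∫ x in Ioi (0 : ℝ), ((Real.exp ((1 / 2 - a) * x) : ℂ) * k x - k 0) / (2 * Real.sinh x : ℂ)) := by
  have hkc : Continuous k := hk.1.continuous
  -- `F_n(x) = e^{-(2n+1)x} h_a(x)`
  have hF : ∀ (n : ℕ) (x : ℝ),
      k x * cexp ((-(2 * (n : ℂ) + a) - 1 / 2) * x) - k 0 * cexp (-(2 * (n : ℂ) + 1) * x) =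
        cexp (-(2 * (n : ℂ) + 1) * x) * ((Real.exp ((1 / 2 - a) * x) : ℂ) * k x - k 0) := by
    intro n x
    have e1 : ((Real.exp ((1 / 2 - a) * x) : ℝ) : ℂ) = cexp ((1 / 2 - (a : ℂ)) * x) := by
      rw [Complex.ofReal_exp]; push_cast; ring_nf
    rw [e1, mul_sub, ← mul_assoc, ← Complex.exp_add]
    have e2 : -(2 * (n : ℂ) + 1) * x + (1 / 2 - (a : ℂ)) * x = (-(2 * (n : ℂ) + a) - 1 / 2) * x := by
      ring
    rw [e2]
    ring
  have hpowC : ∀ (n : ℕ) (x : ℝ), cexp (-(2 * (n : ℂ) + 1) * x) =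
      cexp (-(x : ℂ)) * cexp (-(2 * (x : ℂ))) ^ n := by
    intro n x
    rw [← Complex.exp_nat_mul, ← Complex.exp_add]
    congr 1
    ring
  have hpowR : ∀ (n : ℕ) (x : ℝ), Real.exp (-(2 * (n : ℝ) + 1) * x) =
      Real.exp (-x) * Real.exp (-(2 * x)) ^ n := by
    intro n x
    rw [← Real.exp_nat_mul, ← Real.exp_add]
    congr 1
    ring
  have hnormF : ∀ (n : ℕ) (x : ℝ), ‖cexp (-(2 * (n : ℂ) + 1) * x)‖ = Real.exp (-(2 * (n : ℝ) + 1) * x) := by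
    intro n x
    have hcast : (-(2 * (n : ℂ) + 1) * (x : ℂ)) = ((-(2 * (n : ℝ) + 1) * x : ℝ) : ℂ) := by
      push_cast; ring
    rw [hcast, Complex.norm_exp, Complex.ofReal_re]
  simp_rw [hF]
  refine hasSum_integral_of_dominated_convergence
    (fun (n : ℕ) (x : ℝ) ↦ Real.exp (-(2 * (n : ℝ) + 1) * x) *
      ‖(Real.exp ((1 / 2 - a) * x) : ℂ) * k x - k 0‖)
    (fun n ↦ ?_) (fun n ↦ Eventually.of_forall fun x ↦ ?_) ?_ ?_ ?_
  · exact (by fun_prop : Continuous fun x : ℝ ↦ cexp (-(2 * (n : ℂ) + 1) * x) *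
      ((Real.exp ((1 / 2 - a) * x) : ℂ) * k x - k 0)).aestronglyMeasurable
  · rw [norm_mul, hnormF]
  · refine (ae_restrict_iff' measurableSet_Ioi).2 (Eventually.of_forall fun x (hx : 0 < x) ↦ ?_)
    have h0 : 0 ≤ Real.exp (-(2 * x)) := (Real.exp_pos _).le
    have h1 : Real.exp (-(2 * x)) < 1 := Real.exp_lt_one_iff.2 (by linarith)
    have e : (fun n : ℕ ↦ Real.exp (-(2 * (n : ℝ) + 1) * x) *
        ‖(Real.exp ((1 / 2 - a) * x) : ℂ) * k x - k 0‖) =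
        fun n : ℕ ↦ Real.exp (-x) * ‖(Real.exp ((1 / 2 - a) * x) : ℂ) * k x - k 0‖ *
          Real.exp (-(2 * x)) ^ n := by
      funext n; rw [hpowR]; ring
    rw [e]
    exact (summable_geometric_of_lt_one h0 h1).mul_left _
  · refine ((integrableOn_majorant hk a).congr_fun (fun x (hx : 0 < x) ↦ ?_)
      measurableSet_Ioi).integrable
    have h0 : 0 ≤ Real.exp (-(2 * x)) := (Real.exp_pos _).le
    have h1 : Real.exp (-(2 * x)) < 1 := Real.exp_lt_one_iff.2 (by linarith)
    have e : (fun n : ℕ ↦ Real.exp (-(2 * (n : ℝ) + 1) * x) *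
        ‖(Real.exp ((1 / 2 - a) * x) : ℂ) * k x - k 0‖) =
        fun n : ℕ ↦ Real.exp (-x) * ‖(Real.exp ((1 / 2 - a) * x) : ℂ) * k x - k 0‖ *
          Real.exp (-(2 * x)) ^ n := by
      funext n; rw [hpowR]; ring
    show ‖(Real.exp ((1 / 2 - a) * x) : ℂ) * k x - k 0‖ / (2 * Real.sinh x) =
      ∑' n : ℕ, Real.exp (-(2 * (n : ℝ) + 1) * x) * ‖(Real.exp ((1 / 2 - a) * x) : ℂ) * k x - k 0‖
    rw [e, tsum_mul_left, tsum_geometric_of_lt_one h0 h1, div_eq_mul_one_div,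
      ← exp_neg_div_one_sub_exp hx]
    ring
  · refine (ae_restrict_iff' measurableSet_Ioi).2 (Eventually.of_forall fun x (hx : 0 < x) ↦ ?_)
    have hr : ‖cexp (-(2 * (x : ℂ)))‖ < 1 := by
      have hcast : (-(2 * (x : ℂ))) = ((-(2 * x) : ℝ) : ℂ) := by push_cast; ring
      rw [hcast, Complex.norm_exp, Complex.ofReal_re]
      exact Real.exp_lt_one_iff.2 (by linarith)
    have hgeo := (hasSum_geometric_of_norm_lt_one hr).mul_left
      (cexp (-(x : ℂ)) * ((Real.exp ((1 / 2 - a) * x) : ℂ) * k x - k 0))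
    have hC : cexp (-(x : ℂ)) / (1 - cexp (-(2 * (x : ℂ)))) = 1 / (2 * (Real.sinh x : ℂ)) := by
      have := congrArg (fun r : ℝ ↦ (r : ℂ)) (exp_neg_div_one_sub_exp hx)
      push_cast at this
      rw [Complex.ofReal_sinh]
      exact this
    have ef : (fun n : ℕ ↦ cexp (-(2 * (n : ℂ) + 1) * x) *
        ((Real.exp ((1 / 2 - a) * x) : ℂ) * k x - k 0)) =
        fun n : ℕ ↦ cexp (-(x : ℂ)) * ((Real.exp ((1 / 2 - a) * x) : ℂ) * k x - k 0) *
          cexp (-(2 * (x : ℂ))) ^ n := by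
      funext n
      rw [hpowC]
      ring
    have ev : ((Real.exp ((1 / 2 - a) * x) : ℂ) * k x - k 0) / (2 * (Real.sinh x : ℂ)) =
        cexp (-(x : ℂ)) * ((Real.exp ((1 / 2 - a) * x) : ℂ) * k x - k 0) *
          (1 - cexp (-(2 * (x : ℂ))))⁻¹ := by
      calc ((Real.exp ((1 / 2 - a) * x) : ℂ) * k x - k 0) / (2 * (Real.sinh x : ℂ))
          = ((Real.exp ((1 / 2 - a) * x) : ℂ) * k x - k 0) * (1 / (2 * (Real.sinh x : ℂ))) := by ring
        _ = ((Real.exp ((1 / 2 - a) * x) : ℂ) * k x - k 0) *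
            (cexp (-(x : ℂ)) / (1 - cexp (-(2 * (x : ℂ))))) := by rw [hC]
        _ = _ := by ring
    rw [ef, ev]
    exact hgeo

/-- The terms of the expansion:
`∫₀^∞ (k(x) e^{−(2n+a+1/2)x} − k(0) e^{−(2n+1)x}) dx = ∫₀^∞ k(x)e^{−(2n+a+1/2)x} dx − k(0)/(2n+1)`.
[folklore] -/
private theorem integral_term (hk : IsWeilTest k) (a n : ℕ) :
    ∫ x in Ioi (0 : ℝ),
        (k x * cexp ((-(2 * (n : ℂ) + a) - 1 / 2) * x) - k 0 * cexp (-(2 * (n : ℂ) + 1) * x)) =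
      (∫ x in Ioi (0 : ℝ), k x * cexp ((-(2 * (n : ℂ) + a) - 1 / 2) * x)) -
        k 0 / (2 * (n : ℂ) + 1) := by
  have hn : (0 : ℝ) ≤ n := n.cast_nonneg
  have ha : (-(2 * (n : ℂ) + 1)).re < 0 := by simp; linarith
  have hi1 : IntegrableOn (fun x : ℝ ↦ k x * cexp ((-(2 * (n : ℂ) + a) - 1 / 2) * x)) (Ioi 0) :=
    ((hk.1.continuous.mul (by fun_prop)).integrable_of_hasCompactSupport hk.2.mul_right).integrableOn
  have hi2 : IntegrableOn (fun x : ℝ ↦ k 0 * cexp (-(2 * (n : ℂ) + 1) * x)) (Ioi 0) :=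
    (integrableOn_exp_mul_complex_Ioi ha 0).const_mul _
  rw [integral_sub hi1 hi2, integral_const_mul, integral_exp_mul_complex_Ioi ha 0]
  congr 1
  rw [Complex.ofReal_zero, mul_zero, Complex.exp_zero, neg_div_neg_eq, mul_one_div]

/-! ### The identity -/

/-- **The archimedean term with parity in position space** (Bombieri (2.8) with `w = (s+a)/2`;
Weil's (5), (10): `d log 𝒢_{1,a}(1/2+it)/ds = log 2 + Re ψ((1/2+a+it)/2)`): for every test function
`g` and `a ∈ {0, 1}`, with `k(x) = g(x) + g(−x)`,
`weilArchIntegralChar a g = −2π [ (log 4 + γ) g(0) + ∫₀^∞ (e^{(1/2−a)x} k(x) − 2 g(0)) dx/(2 sinh x) ]`.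
[cite: Bombieri2000Weil, §2 eq. (2.8); Weil1952FormulesExplicites, (10) p. 258] -/
theorem weilArchIntegralChar_eq_position (hg : IsWeilTest g) {a : ℕ} (ha : a ≤ 1) :
    weilArchIntegralChar a g =
      -(2 * π) * (((Real.log 4 : ℝ) : ℂ) * g 0 + Real.eulerMascheroniConstant * g 0 +
        ∫ x in Ioi (0 : ℝ), ((Real.exp ((1 / 2 - a) * x) : ℂ) * (g x + g (-x)) - 2 * g 0) /
          (2 * Real.sinh x : ℂ)) := by
  have hk : IsWeilTest (weilSymm g) := hg.weilSymm
  -- (I) the archimedean integral as a series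
  have h1 := hasSum_weilArchIntegralChar hg ha
  -- (II) Bombieri's integral as a series
  have h2 := hasSum_integral_bombieriTerms_parity hk a
  simp_rw [integral_term hk] at h2
  simp only [weilSymm_zero] at h2
  simp only [weilSymm] at h2
  -- (III) `log 4`
  have h3 := hasSum_two_div_sub_one_div
  -- combine: the series `h1 + 4π h2 + 4π g(0) h3` vanishes termwise
  have hsum := (h1.add (h2.mul_left (4 * π : ℂ))).add (h3.mul_left (4 * π * g 0 : ℂ))
  have hV := (show HasSum (fun _ : ℕ ↦ (0 : ℂ)) _ by
    convert hsum using 1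
    funext n
    ring).unique hasSum_zero
  linear_combination (1 / 2 : ℂ) * hV

end WeilArchParity

end Literature.NumberTheory.LFunctions

end
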